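import Summits.QuantumFields.YangMills.Theorems.BalabanUVNodesPortS1JacRowsDefs
import Literature.MathematicalPhysics.QuantumFieldTheory.Balaban1983to89.B15AveragingHolomorphicTowerRegion

/-!
# NODE O port PT-A — THE TWO HALVES OF `JacRowsAB` ALONG THE PORTER BOUNDARY (director-ym №522 (2)): the complex-domain rows `JacRowsABDom F` (rows (a)(b) of `J_T(c, ·)` at fields whose `k`-fold
# (0.4) averages have SMALL LOOPS on the tower region of `c` — porter PTZ-1's item (3), LOCALIZED) and the `k`-STEP READING `JacKStep F` (a pair of the record space `U^c_{k+1}(X(c), α₀, α₁)` is,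
# after an `SL(2,ℂ)` gauge transformation, tower-loop-small below `k` — [I] p.263 L8–10 «M˙(𝐔) = Ū^p on Λ_p, |∂Ū^p − 1| < 2α₀′(L^pξ)²» with [12] Prop. 2 ∕ [15] Prop. 9, the COMPLEX small-field road)

Cell `ym-nodeO-ideate`, porter seat `ymgap-nodeO-port-PTA-1` (gen 6); DEFINITION file, `--supports stmt-QuantumFields-27930`.  [I] = [Balaban1987RG1], [12] = [Balaban1985Averaging], [15] =
[Balaban1985Variational].  Vocabulary OF RECORD, reused verbatim: the tower region `blockIter (k+1) ⁻¹' {c₋, c₊}` of a coarse bond and its level-`j` bonds `bondsIn j ·` (dag-n12-c's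
`B15AveragingHolomorphicTowerRegion` ∕ `B10Eq42TorusConstraint`), the holomorphic (0.4) loops and iterates `loopMh`, `iterMh` (`B15AveragingHolomorphic`), the action `Sect2.cAct` (11b), the record's
`recordUc`, `encodeCfg`, `McGuard`, `recordK₀` (DEF-1), the porter's `domOfBond`, `jacTorus`, `JacRowsAB`.
WHY.  `JacRowsAB F` (✓ `…JacRowsDefs`, the P0-free stub of the skeleton `pta_residueW`) has two mathematically different layers: (α) COMPLEX ANALYSIS AT ONE TORUS — at a complex fine field `𝐕` with
`det 𝐕 = 1` on the tower region of `c` and ALL (0.4) loop matrices of the averages `Ū^j(𝐕)`, `j ≤ k`, at the coarse bonds of that region within `a` of `1`, the functional `ψ ↦ J_T(c, ψ.1)` is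
analytic and `|J_T(c, 𝐕) − J_T(c, 1)| ≤ E` (dag-n12-c's tower analyticity `B15AveragingHolomorphicLocalAnalytic.analyticAt_iterMh_apply_of_polydiscOn` composed with porter PTZ-1's one-step rows
`…JacobianHoloDomainDet.analyticAt_jacFactorC_of_loopSmall` ∕ `norm_jacFactorC_sub_log_le`, localized to the window by the two-block locality of `J_T`); (β) THE `k`-STEP READING OF (1.11)–(1.16) —
a pair of `recordUc … X(c)` is an `SL(2,ℂ)`-gauge transform (11b's union of orbits) of a pair `(e^{iξA′}U, 𝐉)` satisfying (i)–(iii) on `X(c) ⊇` the tower region ((iv) is vacuous at the record,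
`K0PortChart44DMapsTo.condIV_record`), and for such COMPLEX small fields the `j`-fold averages have small plaquette variables `< 2α₀′(L^jξ)²` ([I] p.263 L8–10, [12] Prop. 2 p.26 — the tree holds
the UNITARY case only: `B7Prop2Explicit.prop2_explicit`, `B12Average012Prop2.prop2_012`) hence small (0.4) loops, UNIFORMLY IN `k` (the scaled norms `ξ = L^{−(k+1)}`).  `J_T` is EXACTLY
invariant under every `det = 1` gauge transformation (✓ `…JacTorusRows.jacTorus_cAct`), so (α) at the gauge-fixed field gives the rows at the original pair: `jacRowsAB_of_kstep_of_dom` (companion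
file `…JacKStepGlue`).
* `TowerLoopSmall k c a 𝐕` — `det 𝐕 = 1` on the fine bonds of the tower region of `c` and `‖loopMh (iterMh j 𝐕) c′ i − 1‖ ≤ a` for `j ≤ k`, `c′` a level-`(j+1)` bond of the region, every index `i`.
* `JacRowsABDom F` — (α): `∃ a > 0, E ≥ 0`, at every level `k + 1 ≤ m + K`, bond `c`, pair `φ` with `TowerLoopSmall k c a φ.1`: `AnalyticAt ℂ (ψ ↦ jacTorus k c ψ.1) φ ∧ ‖jacTorus k c φ.1 − jacTorus k c 1‖ ≤ E`.
* `JacKStep F` — (β): for every `a > 0`, for all large admissible `Mc`, radii `α₀ α₁ > 0` with: every pair of `recordUc F Mc k α₀ α₁ (recordK₀ + n) (X(c))` has a `det = 1` gauge transform that is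
  `TowerLoopSmall k c a`.
NOT PROVED HERE; NOT Literature facts (statements about the tree's own objects at the record).  (α) is M-sized calculus over landed theorems; (β) is GENUINE ([12] Props. 1–2 for complex small
fields ∕ [15] Prop. 9: L-sized, not in the tree).

HONEST FRAMING.  Definitions; NOTHING of Bałaban asserted or proved; `stub_LZjacAB` OPEN; 27930 OPEN · no claim; K0⁷∕K-Ax OPEN; NODE O 0∕1; COUNT 8∕28 · K 1∕4 UNMOVED; finite `𝕋⁴_{L^K}` at fixed
ε — NOT continuum ∕ OS ∕ Clay; **the Yang–Mills mass gap is NOT proved by any of this.**  No `sorry`, no `instance`, no `notation`; standard axioms.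
-/

noncomputable section

open scoped BigOperators Matrix.Norms.L2Operator Topology

namespace Summit.QuantumFields.YangMills.Theorems.BalabanUVNodesPortS1

open Summit.QuantumFields.YangMills.Theorems.K0RecordFormatNames
open Literature.MathematicalPhysics.QuantumFieldTheory.Balaban1983to89
open Literature.MathematicalPhysics.QuantumFieldTheory.Balaban1983to89.Node00
open Literature.MathematicalPhysics.QuantumFieldTheory.Balaban1983to89.T4Continuum (T4Family)
open Literature.MathematicalPhysics.QuantumFieldTheory.Balaban1983to89.BlockAveraging (Idx)
open Literature.MathematicalPhysics.QuantumFieldTheory.Balaban1983to89.B15AveragingHolomorphic (loopMh iterMh)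
open Literature.MathematicalPhysics.QuantumFieldTheory.Balaban1983to89.B10Eq42TorusConstraint (bondsIn)

/-- **`TowerLoopSmall k c a 𝐕` — TOWER LOOP-SMALLNESS of a complex fine field at a level-`(k+1)` bond `c`**: on the tower region `B^{k+1} ⁻¹' {c₋, c₊}` (the two `(k+1)`-blocks under `c`),
`det 𝐕(b) = 1` at every fine bond `b` of the region, and for every `j ≤ k`, every level-`(j+1)` bond `c′` of the region and every index `i`, the (0.4) loop matrix of the `j`-fold average satisfies
`‖loopMh (iterMh j 𝐕) c′ i − 1‖ ≤ a` (the currency of dag-n12-c's tower analyticity and of porter PTZ-1's one-step rows). [cite: Balaban1987RG1, (0.4) p.253, p.263 L8–10; Balaban1985Variational, Prop. 9 p.309] -/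
def TowerLoopSmall {P : Params} (k : ℕ) (c : PBond P (k + 1)) (a : ℝ) (V : PBond P 0 → MatA 2) : Prop :=
  (∀ b : PBond P 0, b ∈ bondsIn 0 (B14.Eq22Determines.blockIter (k + 1) ⁻¹' ({c.src, c.tgt} : Set (Site P (k + 1)))) → (V b).det = 1) ∧
    ∀ j : ℕ, j ≤ k → ∀ c' : PBond P (j + 1), c' ∈ bondsIn (j + 1) (B14.Eq22Determines.blockIter (k + 1) ⁻¹' ({c.src, c.tgt} : Set (Site P (k + 1)))) →
      ∀ i : Idx P, ‖loopMh (iterMh j V) c' i - 1‖ ≤ a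

/-- ★★ **`JacRowsABDom F` — ROWS (a)(b) OF `J_T(c, ·)` ON THE TOWER-LOOP-SMALL `SL(2,ℂ)` DOMAIN** (porter PTZ-1's item (3), localized to the window): there are a loop threshold `a > 0` and a bound
`E ≥ 0` such that at every level `k + 1 ≤ m + K`, coarse bond `c` and pair `φ` with `TowerLoopSmall k c a φ.1`, the functional `ψ ↦ jacTorus k c ψ.1` is ℂ-analytic at `φ` and
`‖jacTorus k c φ.1 − jacTorus k c 1‖ ≤ E`. [cite: Balaban1987RG1, p.267–268 («h(c)» analytic), (1.18) p.263, (0.4) p.253; Balaban1985Variational, Prop. 9 p.309] -/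
def JacRowsABDom (F : T4Family) : Prop :=
  ∃ a E : ℝ, 0 < a ∧ 0 ≤ E ∧ ∀ (k K : ℕ), k + 1 ≤ (F.P K).m + (F.P K).K →
    ∀ (c : PBond (F.P K) (k + 1)) (φ : Sect2.CPair (F.P K) (MatA 2)), TowerLoopSmall k c a φ.1 →
      AnalyticAt ℂ (fun ψ : Sect2.CPair (F.P K) (MatA 2) => jacTorus k c ψ.1) φ ∧ ‖jacTorus k c φ.1 - jacTorus k c 1‖ ≤ E

/-- ★★ **`JacKStep F` — THE `k`-STEP READING OF (1.11)–(1.16) AT THE RECORD**: for every loop threshold `a > 0`, for all large admissible cube letters `Mc`, there are radii `α₀ α₁ > 0` such that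
every pair `φ` of the record space `recordUc F Mc k α₀ α₁ (recordK₀ F Mc k + n) (X(c))` admits a `det = 1` gauge transformation `u` with `TowerLoopSmall k c a (φ^u).1` — the pair is an
`SL(2,ℂ)`-orbit point of a configuration satisfying (i)–(iii) on `X(c)`, whose `j`-fold averages have plaquette variables `< 2α₀′(L^jξ)²` and hence small (0.4) loops, uniformly in `k`
(«M˙(𝐔) = Ū^p on Λ_p, |∂Ū^p − 1| < 2α₀′(L^pξ)²»). [cite: Balaban1987RG1, p.263 L8–10, (1.11)–(1.16) p.262; Balaban1985Averaging, Prop. 2 p.26; Balaban1985Variational, Prop. 9 p.309] -/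
def JacKStep (F : T4Family) : Prop :=
  ∀ a : ℝ, 0 < a → ∃ Mth : ℕ, ∀ Mc : ℕ, Mth ≤ Mc → McGuard F Mc → ∃ α₀ α₁ : ℝ, 0 < α₀ ∧ 0 < α₁ ∧
    ∀ (k n : ℕ) (c : PBond (F.P (recordK₀ F Mc k + n)) (k + 1)) (φ : Sect2.CPair (F.P (recordK₀ F Mc k + n)) (MatA 2)),
      encodeCfg F (recordK₀ F Mc k + n) φ ∈ recordUc F Mc k α₀ α₁ (recordK₀ F Mc k + n) (domOfBond F Mc k (recordK₀ F Mc k + n) c) →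
        ∃ u : Site (F.P (recordK₀ F Mc k + n)) 0 → (MatA 2)ˣ, (∀ x, ((u x : (MatA 2)ˣ) : MatA 2).det = 1) ∧ TowerLoopSmall k c a (Sect2.cAct u φ).1

end Summit.QuantumFields.YangMills.Theorems.BalabanUVNodesPortS1

end
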